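import Literature.Topology.FourManifolds.RouteMonotone
import HarnessLib

/-!
# The route of the slid attaching circle is a graph over the twisted height, II: down the push-off

Topic `Literature/Topology/FourManifolds`; fact seat `provefact-IsStrictHandleSlide.isSurgery`
(R. C. Kirby, *The Topology of 4-Manifolds*, LNM 1374 (1989), Ch. I §4, Fig. 4.2; remaining content:
the named fact (S) `Literature.Topology.FourManifolds.FramedLink.IsStrictHandleSlide.slideModel`).
Continuation of `RouteMonotone.lean`. After the landing at `t_L` the track runs down the push-off
(`X₁ = 1`, `H₁` strictly decreasing), so in the slice `r = 1` and the angle `θ = Θ (H₁)` increases;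
the twist angle `α = twistAngle c 1 θ` increases with `θ` and was already `> π/2` at the landing
(`RouteHyp.α_tL_mem`), so `cos α < 0` and the twisted height `y = sin α` keeps decreasing as long
as `θ < π` (before the far point of the push-off). With `RouteMonotone.lean` this gives the
monotonicity of `y` on the whole parameter range `[t_D, τ₁]` (`RouteHyp.strictAntiOn_y_ext`).

## References

* R. C. Kirby, *The Topology of 4-Manifolds*, LNM 1374, Springer (1989), Ch. I §4. [Kirby1989]
-/

open scoped Topology ContDiff
open Set Real Filter

noncomputable section

namespace Literature.Topology.FourManifolds

namespace RouteHyp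

variable {d : K2LiteData} (R : RouteHyp d)

/-- **Beyond the landing the route is the push-off**: `r = 1` on `[t_L, ∞)`. [folklore] -/
theorem r_of_tL_le {τ : ℝ} (hτ : d.tL ≤ τ) : R.r τ = 1 := by rw [r, d.X₁_of_tL_le hτ]; ring

/-- Down the push-off the curve data: `HasDerivAt r 0`, `HasDerivAt θ (Θ' H₁')`. [folklore] -/
theorem hasDerivAt_r_P {τ : ℝ} (hτ : d.tL < τ) : HasDerivAt R.r 0 τ := by
  have hev : R.r =ᶠ[𝓝 τ] fun _ ↦ (1 : ℝ) :=
    Filter.eventuallyEq_of_mem (Ioi_mem_nhds hτ) fun σ hσ ↦ R.r_of_tL_le (le_of_lt hσ)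
  exact (hasDerivAt_const τ (1 : ℝ)).congr_of_eventuallyEq hev

/-- **Down the push-off `ẏ < 0`** as long as the heights stay in the window and the angle is
below `π`. [folklore] -/
theorem deriv_y_neg_P {τ₁ : ℝ} (hτ₁ : τ₁ ≤ d.b + d.ε) (hwinP : ∀ τ ∈ Icc d.tL τ₁, d.H₁ τ ∈ Ioo R.w₁ R.w₂)
    (hΘπ : ∀ τ ∈ Icc d.tL τ₁, R.Θ (d.H₁ τ) < π) (hΘneg : ∀ h ∈ Ioo R.w₁ R.w₂, deriv R.Θ h < 0)
    {τ : ℝ} (hτ : τ ∈ Ioc d.tL τ₁) :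
    HasDerivAt R.y (cos (R.α τ) * (twistQ R.c 1 (R.θ τ) * (deriv R.Θ (d.H₁ τ) * deriv d.H₁ τ))) τ ∧
      cos (R.α τ) * (twistQ R.c 1 (R.θ τ) * (deriv R.Θ (d.H₁ τ) * deriv d.H₁ τ)) < 0 := by
  have hτ' : τ ∈ Icc d.tL τ₁ := ⟨hτ.1.le, hτ.2⟩
  have hwin := hwinP τ hτ'
  -- derivative data
  have hH : HasDerivAt d.H₁ (deriv d.H₁ τ) τ := (d.contDiff_H₁.differentiable (by simp) τ).hasDerivAt
  have hΘd : HasDerivAt R.Θ (deriv R.Θ (d.H₁ τ)) (d.H₁ τ) :=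
    ((R.Θ_smooth.differentiableOn (by simp)).differentiableAt (Ioo_mem_nhds hwin.1 hwin.2)).hasDerivAt
  have hθ : HasDerivAt R.θ (deriv R.Θ (d.H₁ τ) * deriv d.H₁ τ) τ := hΘd.comp τ hH
  have hr := R.hasDerivAt_r_P hτ.1
  -- the angle lies in `(0, π)`: it is above the landing angle, which is positive
  have hθL : 0 < R.θ d.tL := R.θ_pos ⟨d.tD_lt_tL.le, le_rfl⟩
  have hΘanti : AntitoneOn R.Θ (Ioo R.w₁ R.w₂) :=
    (antitoneOn_of_deriv_nonpos (convex_Ioo _ _) (R.Θ_smooth.continuousOn)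
      ((R.Θ_smooth.differentiableOn (by simp)).mono interior_subset) fun h hh ↦ by
        rw [interior_Ioo] at hh; exact (hΘneg h hh).le)
  have hHanti := d.strictAntiOn_H₁
  have htL_le : d.tL ≤ d.b + d.ε := by linarith [d.tL_mem.2, d.ε_pos]
  have hHle : d.H₁ τ ≤ d.H₁ d.tL :=
    (hHanti.antitoneOn ⟨le_rfl, htL_le⟩ ⟨hτ.1.le, hτ.2.trans hτ₁⟩ hτ.1.le)
  have hθge : R.θ d.tL ≤ R.θ τ := by
    rw [θ, θ]
    exact hΘanti hwin (hwinP d.tL ⟨le_rfl, hτ.1.le.trans hτ.2⟩) hHle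
  have hθmem : R.θ τ ∈ Ioo (-π) π := ⟨by linarith [pi_pos], hΘπ τ hτ'⟩
  have hθLmem : R.θ d.tL ∈ Ioo (-π) π := R.θ_mem_Ioo ⟨d.tD_lt_tL.le, le_rfl⟩
  -- `y' = cos α · q · θ'` with `r = 1`, `r' = 0`
  have hy := hasDerivAt_curveY R.c hr hθ hθmem
  have hr1 : R.r τ = 1 := R.r_of_tL_le hτ.1.le
  simp only [zero_mul, mul_zero, zero_add] at hy
  rw [hr1, one_mul] at hy
  have hαeq : R.α τ = twistAngle R.c 1 (R.θ τ) := by rw [α, hr1]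
  refine ⟨?_, ?_⟩
  · rw [hαeq]; exact hy
  -- signs: `cos α < 0`, `q > 0`, `Θ' < 0`, `H₁' < 0`
  have hαL := R.α_tL_mem
  have hαge : R.α d.tL ≤ R.α τ := by
    rw [hαeq, α, R.r_tL]
    exact (strictMonoOn_twistAngle R.c 1).monotoneOn hθLmem hθmem hθge
  have hαlt : R.α τ < π := by rw [hαeq]; exact (twistAngle_mem_Ioo R.c 1 (R.θ τ)).2
  have hcos : cos (R.α τ) < 0 := cos_neg_of_pi_div_two_lt_of_lt (by linarith [hαL.1]) (by linarith [pi_pos])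
  have hq : 0 < twistQ R.c 1 (R.θ τ) := twistQ_pos R.c 1 hθmem
  have hΘ' : deriv R.Θ (d.H₁ τ) < 0 := hΘneg _ hwin
  have hH' : deriv d.H₁ τ < 0 := d.deriv_H₁_neg ⟨hτ.1.le, hτ.2.trans hτ₁⟩
  have hprod : 0 < deriv R.Θ (d.H₁ τ) * deriv d.H₁ τ := mul_pos_of_neg_of_neg hΘ' hH'
  exact mul_neg_of_neg_of_pos hcos (mul_pos hq hprod)

/-- **The twisted height is strictly decreasing along the whole route from the tip down the
push-off**, on `[t_D, τ₁]`. [cite: Kirby1989, Ch. I §4] -/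
theorem strictAntiOn_y_ext {τ₁ : ℝ} (hτ₁ : τ₁ ≤ d.b + d.ε)
    (hwinP : ∀ τ ∈ Icc d.tL τ₁, d.H₁ τ ∈ Ioo R.w₁ R.w₂)
    (hΘπ : ∀ τ ∈ Icc d.tL τ₁, R.Θ (d.H₁ τ) < π) (hΘneg : ∀ h ∈ Ioo R.w₁ R.w₂, deriv R.Θ h < 0) :
    StrictAntiOn R.y (Icc d.tD τ₁) := by
  -- derivative everywhere on `[t_D, τ₁]`, negative
  have hd : ∀ τ ∈ Icc d.tD τ₁, HasDerivAt R.y (deriv R.y τ) τ ∧ deriv R.y τ < 0 := by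
    intro τ hτ
    rcases le_or_gt τ d.tL with h | h
    · have h' : τ ∈ Icc d.tD d.tL := ⟨hτ.1, h⟩
      exact ⟨by have := R.hasDerivAt_y h'; rwa [← this.deriv] at this, R.deriv_y_neg h'⟩
    · obtain ⟨hy, hneg⟩ := R.deriv_y_neg_P hτ₁ hwinP hΘπ hΘneg ⟨h, hτ.2⟩
      rw [← hy.deriv] at hneg
      exact ⟨by rwa [← hy.deriv] at hy, hneg⟩
  refine strictAntiOn_of_deriv_neg (convex_Icc _ _) (fun τ hτ ↦ (hd τ hτ).1.continuousAt.continuousWithinAt) ?_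
  intro τ hτ
  rw [interior_Icc] at hτ
  exact (hd τ (Ioo_subset_Icc_self hτ)).2

/-- Down the push-off `y = sin (twistAngle c 1 θ)`. [folklore] -/
theorem y_of_tL_le {τ : ℝ} (hτ : d.tL ≤ τ) : R.y τ = sin (twistAngle R.c 1 (R.θ τ)) := by
  rw [y, α, R.r_of_tL_le hτ, one_mul]

end RouteHyp

end Literature.Topology.FourManifolds
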